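import Summits.ResolutionOfSingularities.ResolutionOfSingularities.Theses.HilbertSamuelElimination
import Summits.ResolutionOfSingularities.ResolutionOfSingularities.Theorems.HilbertSamuelEliminationSigmaMaxModificationsStubCentreSeqPackage
import Summits.ResolutionOfSingularities.ResolutionOfSingularities.Theorems.HilbertSamuelEliminationSigmaMaxModificationsStubSigmaMaxModificationOfNuModifications
import Summits.ResolutionOfSingularities.ResolutionOfSingularities.Theorems.HilbertSamuelEliminationSigmaMaxModificationsDimThreeIsolated
import Summits.ResolutionOfSingularities.ResolutionOfSingularities.Theorems.HilbertSamuelEliminationSigmaMaxModificationsEliminationIsModification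
import Summits.ResolutionOfSingularities.ResolutionOfSingularities.Theorems.HilbertSamuelEliminationSigmaMaxModificationsGluing
import Literature.AlgebraicGeometry.Resolution.SurfaceResolutionSigmaMaxElimination
import Summits.ResolutionOfSingularities.ResolutionOfSingularities.Theorems.SigmaMaxModifications.Negative.Levels
import Summits.ResolutionOfSingularities.ResolutionOfSingularities.Theorems.HilbertSamuelEliminationSigmaMaxModificationsCurveResolution
import Summits.ResolutionOfSingularities.ResolutionOfSingularities.Theorems.HilbertSamuelEliminationSigmaMaxModificationsCurve
import Summits.ResolutionOfSingularities.ResolutionOfSingularities.Theorems.HilbertSamuelEliminationSigmaMaxModificationsGradedGlue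
import Summits.ResolutionOfSingularities.ResolutionOfSingularities.Theorems.HilbertSamuelEliminationSigmaMaxModificationsSurfaceNuMods
import Summits.ResolutionOfSingularities.ResolutionOfSingularities.Theorems.HilbertSamuelEliminationSigmaMaxModificationsSemicontinuitySharp
import Summits.ResolutionOfSingularities.ResolutionOfSingularities.Theorems.HilbertSamuelEliminationSigmaMaxModificationsMaxLocusClosed
import Summits.ResolutionOfSingularities.ResolutionOfSingularities.Theorems.HilbertSamuelEliminationSigmaMaxModificationsSurfaceAllLevels
import Literature.AlgebraicGeometry.Resolution.QuasiExcellentSchemesProofs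
import Literature.AlgebraicGeometry.Resolution.HilbertSamuelLowerBound
import Literature.AlgebraicGeometry.Resolution.BlowupReducedDimension
import Literature.AlgebraicGeometry.Resolution.HilbertSamuelIsolatedSingularities
import Literature.AlgebraicGeometry.Resolution.HilbertSamuelGenericConstancyExcellent
import Literature.AlgebraicGeometry.Resolution.RegularLocusDense
import Literature.AlgebraicGeometry.Resolution.ExcellentRingsFieldProofs
import Literature.AlgebraicGeometry.Resolution.BlowupSequences
import Mathlib.AlgebraicGeometry.Morphisms.Proper
import Mathlib.AlgebraicGeometry.Noetherian
import HarnessLib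

/-!
# `SigmaMaxModifications` (crux stmt-ResolutionOfSingularities-18506, route HilbertSamuelElimination):
# REDUCTION of the crux to its open cores, modulo two printed theorems

The line `Sketch` (lead gens 0–1) proves every part of the crux
`Summit.ResolutionOfSingularities.ResolutionOfSingularities.Theses.HilbertSamuelElimination.SigmaMaxModifications`
(CJS, LNM 2270, Def. 6.15 in modification form: for `X/k` reduced separated of finite type, not
regular, `char k = p`, and `N ≥ dim X`, a proper `π : X' → X` from a reduced `X'` of dimension
`≤ N`, an isomorphism over every open inside `X ∖ X_max` with dense preimage of `X ∖ X_max`,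
`H^N` non-increasing, killing the maximal values of `Σ_X`) that is known, and isolates what is
open. This file records the outcome as ONE kernel-checked equivalence,
`sigmaMaxModifications_iff_open_cores`: ASSUMING the two printed theorems vendored in the tree as
named facts —

* `CossartJannsenSaito2020_sigmaMaxElimination` (CJS Thm. 6.28 with Thm. 3.10 (1), glued by
  Def. 6.14: `Σ^max`-eliminations of reduced excellent surfaces, level `2`), and
* `CossartPiltant2019General` (Cossart–Piltant 2019, Thm. 1.1: resolution of reduced
  quasi-excellent threefolds, an isomorphism over the regular locus) —

the crux is EQUIVALENT to the conjunction of its two open cores: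

* (corridor) the crux body for `dim X = 3` when `X_max` meets `closure (Sing X ∖ X_max)`;
* (high dimension) the crux body for `dim X ≥ 4`.

Everything else is proved in the tree and assembled here: curves (`stub_curve` ∘
`stub_curveResolution`: point blow-ups, `δ`-drop, component glue, isolated gluing — p156715,
p156708); surfaces at every level `N ≥ 2` (`stub_surface_of_sigmaMaxFact`, p159874: the level-2
fact transferred level by level through the open neighbourhood `{H^N ≤ μ, μ ∈ S}` of
`X_max(N+1)`, which needs the SHARP upper semicontinuity of `H^N` at `N ≥ dim X` — Bennett–Singh,
HIO Thm. (30.2), landed as `BennettDimOneSharp` / `HilbertSamuelSemicontinuitySharp`, p157979 /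
p158258 / p158563 / p157713); threefolds with isolated `X_max` (`sigmaMaxModifications_dim_le_three_of_isolated`,
p154168, now at every `N ≥ 3` since `X_max` is closed at `N = dim X`).

## Sources

* V. Cossart, U. Jannsen, S. Saito, LNM 2270 (2020): Def. 6.14/6.15, Thm. 6.28, Rem. 6.29,
  Thm. 2.33, Lemma 2.36. [CossartJannsenSaito2020]
* V. Cossart, O. Piltant, J. Algebra 529 (2019), Thm. 1.1, §1. [CossartPiltant2019]
* M. Herrmann, S. Ikeda, U. Orbanz, *Equimultiplicity and Blowing up* (1988), Thm. (30.2).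
  [HerrmannIkedaOrbanz1988]
-/

set_option linter.dupNamespace false -- mandated namespace of this single-conjunct summit

noncomputable section

open CategoryTheory AlgebraicGeometry TopologicalSpace Topology
open Literature.AlgebraicGeometry.Resolution Literature.RingTheory.HilbertSamuel
open Summit.ResolutionOfSingularities.ResolutionOfSingularities.Theses.HilbertSamuelElimination

namespace Summit.ResolutionOfSingularities.ResolutionOfSingularities.Theorems.SigmaMaxModifications.Sketch

/-! ## Dimension bookkeeping in `WithBot ℕ∞` -/

/-- Dichotomy in `WithBot ℕ∞`: `D ≤ m` or `m + 1 ≤ D`. [folklore] -/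
theorem dim_le_or_succ_le (D : WithBot ℕ∞) (m : ℕ) :
    D ≤ (m : WithBot ℕ∞) ∨ ((m + 1 : ℕ) : WithBot ℕ∞) ≤ D := by
  induction D using WithBot.recBotCoe with
  | bot => exact Or.inl bot_le
  | coe d =>
    induction d using ENat.recTopCoe with
    | top => exact Or.inr (by exact_mod_cast le_top)
    | coe d =>
      have cast : ∀ n : ℕ, ((n : ℕ∞) : WithBot ℕ∞) = (n : WithBot ℕ∞) := fun n => rfl
      rw [cast]
      rcases Nat.lt_or_ge d (m + 1) with h | h
      · exact Or.inl (Nat.cast_le.mpr (by omega))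
      · exact Or.inr (Nat.cast_le.mpr h)

/-- Trichotomy of a dimension in `WithBot ℕ∞`: `≤ 1`, or `≤ 2` (and `≥ 2`), or `≥ 3`.
[folklore] -/
theorem dim_trichotomy (D : WithBot ℕ∞) :
    D ≤ ((1 : ℕ) : WithBot ℕ∞) ∨
      (((2 : ℕ) : WithBot ℕ∞) ≤ D ∧ D ≤ ((2 : ℕ) : WithBot ℕ∞)) ∨
      ((3 : ℕ) : WithBot ℕ∞) ≤ D := by
  induction D using WithBot.recBotCoe with
  | bot => exact Or.inl bot_le
  | coe d =>
    induction d using ENat.recTopCoe with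
    | top => exact Or.inr (Or.inr (by exact_mod_cast le_top))
    | coe d =>
      have cast : ∀ n : ℕ, ((n : ℕ∞) : WithBot ℕ∞) = (n : WithBot ℕ∞) := fun n => rfl
      rw [cast]
      rcases Nat.lt_or_ge d 2 with h | h
      · exact Or.inl (Nat.cast_le.mpr (by omega))
      · rcases Nat.lt_or_ge d 3 with h' | h'
        · exact Or.inr (Or.inl ⟨Nat.cast_le.mpr h, Nat.cast_le.mpr (by omega)⟩)
        · exact Or.inr (Or.inr (Nat.cast_le.mpr h'))

/-- `m ≤ D ≤ N` in `WithBot ℕ∞` for naturals `m, N` forces `m ≤ N`. [folklore] -/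
theorem nat_le_of_le_dim_le {m N : ℕ} {D : WithBot ℕ∞} (h1 : ((m : ℕ) : WithBot ℕ∞) ≤ D)
    (h2 : D ≤ (N : WithBot ℕ∞)) : m ≤ N := by
  have h := h1.trans h2
  exact_mod_cast h

/-! ## Dimension `≥ 3` from the open cores -/

/-- **Dimension `≥ 3`, modulo Cossart–Piltant and the two open cores**: `dim X = 3` isolated —
Cossart–Piltant resolution of a neighbourhood of `X_max` glued with the identity
(`sigmaMaxModifications_dim_le_three_of_isolated`, `X_max` closed by the sharp semicontinuity
`stub_isClosed_hsMaxLocus_over_field`); `dim X = 3` corridor — the hypothesis `hcorridor`;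
`dim X ≥ 4` — the hypothesis `hge4`. [cite: CossartJannsenSaito2020, Def. 6.15, Rem. 6.29]
[cite: CossartPiltant2019, Thm. 1.1] -/
theorem sigmaMaxModifications_dim_ge_three_of_open_cores (hCP : CossartPiltant2019General.{0})
    (hcorridor : ∀ p : ℕ, p.Prime → ∀ (k : Type) [Field k] [CharP k p] (X : Scheme.{0})
      (f : X ⟶ Spec (.of k)), IsSeparated f → LocallyOfFiniteType f → QuasiCompact f →
      IsReduced X → ¬ Scheme.IsRegular X → ((3 : ℕ) : WithBot ℕ∞) ≤ topologicalKrullDim X →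
      topologicalKrullDim X ≤ 3 → ∀ N : ℕ, topologicalKrullDim X ≤ (N : WithBot ℕ∞) →
      ¬ Disjoint (closure ((Scheme.regularLocus X)ᶜ \ Scheme.hsMaxLocus X N))
          (Scheme.hsMaxLocus X N) →
        ∃ (X' : Scheme.{0}) (π : X' ⟶ X), IsProper π ∧ IsReduced X' ∧
          topologicalKrullDim X' ≤ (N : WithBot ℕ∞) ∧
          (∀ U : X.Opens, (U : Set X) ⊆ (Scheme.hsMaxLocus X N)ᶜ → IsIso (π ∣_ U)) ∧
          Dense ((fun x' => π.base x') ⁻¹' (Scheme.hsMaxLocus X N)ᶜ) ∧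
          (∀ x' : X', Scheme.hsFun X' N x' ≤ Scheme.hsFun X N (π.base x')) ∧
          ∀ ν : ℕ → ℕ, Maximal (· ∈ Scheme.hsValues X N) ν → ν ∉ Scheme.hsValues X' N)
    (hge4 : ∀ p : ℕ, p.Prime → ∀ (k : Type) [Field k] [CharP k p] (X : Scheme.{0})
      (f : X ⟶ Spec (.of k)), IsSeparated f → LocallyOfFiniteType f → QuasiCompact f →
      IsReduced X → ¬ Scheme.IsRegular X → ((4 : ℕ) : WithBot ℕ∞) ≤ topologicalKrullDim X →
      ∀ N : ℕ, topologicalKrullDim X ≤ (N : WithBot ℕ∞) →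
        ∃ (X' : Scheme.{0}) (π : X' ⟶ X), IsProper π ∧ IsReduced X' ∧
          topologicalKrullDim X' ≤ (N : WithBot ℕ∞) ∧
          (∀ U : X.Opens, (U : Set X) ⊆ (Scheme.hsMaxLocus X N)ᶜ → IsIso (π ∣_ U)) ∧
          Dense ((fun x' => π.base x') ⁻¹' (Scheme.hsMaxLocus X N)ᶜ) ∧
          (∀ x' : X', Scheme.hsFun X' N x' ≤ Scheme.hsFun X N (π.base x')) ∧
          ∀ ν : ℕ → ℕ, Maximal (· ∈ Scheme.hsValues X N) ν → ν ∉ Scheme.hsValues X' N) :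
    ∀ p : ℕ, p.Prime → ∀ (k : Type) [Field k] [CharP k p] (X : Scheme.{0})
      (f : X ⟶ Spec (.of k)), IsSeparated f → LocallyOfFiniteType f → QuasiCompact f →
      IsReduced X → ¬ Scheme.IsRegular X → ((3 : ℕ) : WithBot ℕ∞) ≤ topologicalKrullDim X →
      ∀ N : ℕ, topologicalKrullDim X ≤ (N : WithBot ℕ∞) →
        ∃ (X' : Scheme.{0}) (π : X' ⟶ X), IsProper π ∧ IsReduced X' ∧
          topologicalKrullDim X' ≤ (N : WithBot ℕ∞) ∧
          (∀ U : X.Opens, (U : Set X) ⊆ (Scheme.hsMaxLocus X N)ᶜ → IsIso (π ∣_ U)) ∧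
          Dense ((fun x' => π.base x') ⁻¹' (Scheme.hsMaxLocus X N)ᶜ) ∧
          (∀ x' : X', Scheme.hsFun X' N x' ≤ Scheme.hsFun X N (π.base x')) ∧
          ∀ ν : ℕ → ℕ, Maximal (· ∈ Scheme.hsValues X N) ν → ν ∉ Scheme.hsValues X' N := by
  intro p hp k _ _ X f hsep hft hqc hred hreg h3 N hdim
  by_cases h3' : topologicalKrullDim X ≤ ((3 : ℕ) : WithBot ℕ∞)
  · -- dimension exactly 3
    by_cases hdisj : Disjoint (closure ((Scheme.regularLocus X)ᶜ \ Scheme.hsMaxLocus X N))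
        (Scheme.hsMaxLocus X N)
    · have hcl : IsClosed (Scheme.hsMaxLocus X N) :=
        (stub_isClosed_hsMaxLocus_over_field stub_hsFun_le_of_specializes_over_field k X f hft
          hqc N hdim).2
      exact sigmaMaxModifications_dim_le_three_of_isolated hCP k X f hsep hft hqc hred hreg
        (by exact_mod_cast h3') N hdim hcl hdisj
    · exact hcorridor p hp k X f hsep hft hqc hred hreg h3 (by exact_mod_cast h3') N hdim hdisj
  · -- dimension ≥ 4
    have h4 : ((4 : ℕ) : WithBot ℕ∞) ≤ topologicalKrullDim X := by
      rcases dim_le_or_succ_le (topologicalKrullDim X) 3 with h | h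
      · exact absurd h h3'
      · exact h
    exact hge4 p hp k X f hsep hft hqc hred hreg h4 N hdim

/-! ## The reduction -/

/-- **The crux from its open cores, modulo the two printed theorems** (trichotomy on `dim X`):
curves — `stub_curve` fed by `stub_curveResolution`; surfaces — `stub_surface_of_sigmaMaxFact`
from the glued CJS fact `hCJS`, at every level; `dim X ≥ 3` —
`sigmaMaxModifications_dim_ge_three_of_open_cores`. The inline `H^N` of the route decl is
`Scheme.hsFun` by `rfl`. [cite: CossartJannsenSaito2020, Def. 6.15, Thm. 6.28, Rem. 6.29]
[cite: CossartPiltant2019, Thm. 1.1] -/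
theorem sigmaMaxModifications_of_open_cores (hCJS : CossartJannsenSaito2020_sigmaMaxElimination.{0})
    (hCP : CossartPiltant2019General.{0})
    (hcorridor : ∀ p : ℕ, p.Prime → ∀ (k : Type) [Field k] [CharP k p] (X : Scheme.{0})
      (f : X ⟶ Spec (.of k)), IsSeparated f → LocallyOfFiniteType f → QuasiCompact f →
      IsReduced X → ¬ Scheme.IsRegular X → ((3 : ℕ) : WithBot ℕ∞) ≤ topologicalKrullDim X →
      topologicalKrullDim X ≤ 3 → ∀ N : ℕ, topologicalKrullDim X ≤ (N : WithBot ℕ∞) →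
      ¬ Disjoint (closure ((Scheme.regularLocus X)ᶜ \ Scheme.hsMaxLocus X N))
          (Scheme.hsMaxLocus X N) →
        ∃ (X' : Scheme.{0}) (π : X' ⟶ X), IsProper π ∧ IsReduced X' ∧
          topologicalKrullDim X' ≤ (N : WithBot ℕ∞) ∧
          (∀ U : X.Opens, (U : Set X) ⊆ (Scheme.hsMaxLocus X N)ᶜ → IsIso (π ∣_ U)) ∧
          Dense ((fun x' => π.base x') ⁻¹' (Scheme.hsMaxLocus X N)ᶜ) ∧
          (∀ x' : X', Scheme.hsFun X' N x' ≤ Scheme.hsFun X N (π.base x')) ∧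
          ∀ ν : ℕ → ℕ, Maximal (· ∈ Scheme.hsValues X N) ν → ν ∉ Scheme.hsValues X' N)
    (hge4 : ∀ p : ℕ, p.Prime → ∀ (k : Type) [Field k] [CharP k p] (X : Scheme.{0})
      (f : X ⟶ Spec (.of k)), IsSeparated f → LocallyOfFiniteType f → QuasiCompact f →
      IsReduced X → ¬ Scheme.IsRegular X → ((4 : ℕ) : WithBot ℕ∞) ≤ topologicalKrullDim X →
      ∀ N : ℕ, topologicalKrullDim X ≤ (N : WithBot ℕ∞) →
        ∃ (X' : Scheme.{0}) (π : X' ⟶ X), IsProper π ∧ IsReduced X' ∧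
          topologicalKrullDim X' ≤ (N : WithBot ℕ∞) ∧
          (∀ U : X.Opens, (U : Set X) ⊆ (Scheme.hsMaxLocus X N)ᶜ → IsIso (π ∣_ U)) ∧
          Dense ((fun x' => π.base x') ⁻¹' (Scheme.hsMaxLocus X N)ᶜ) ∧
          (∀ x' : X', Scheme.hsFun X' N x' ≤ Scheme.hsFun X N (π.base x')) ∧
          ∀ ν : ℕ → ℕ, Maximal (· ∈ Scheme.hsValues X N) ν → ν ∉ Scheme.hsValues X' N) :
    SigmaMaxModifications := by
  intro p hp k _ _ X f hsep hft hqc hred hreg N hdim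
  rcases dim_trichotomy (topologicalKrullDim X) with h1 | ⟨h2, h2'⟩ | h3
  · exact stub_curve stub_curveResolution k X f hsep hft hqc hred hreg h1 N hdim
  · exact stub_surface_of_sigmaMaxFact hCJS k N (nat_le_of_le_dim_le h2 hdim) X f hsep hft hqc
      hred hreg h2' hdim
  · exact sigmaMaxModifications_dim_ge_three_of_open_cores hCP hcorridor hge4 p hp k X f hsep hft
      hqc hred hreg h3 N hdim

/-- **Equivalence: modulo `CossartJannsenSaito2020_sigmaMaxElimination` and
`CossartPiltant2019General`, the crux `SigmaMaxModifications` is exactly the conjunction of its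
two open cores** — the corridor case in dimension `3` and everything from dimension `4` (both
are restrictions of the crux, so the forward direction is trivial). This is the honest content
of item stmt-ResolutionOfSingularities-18506 after line `Sketch`.
[cite: CossartJannsenSaito2020, Def. 6.15, Rem. 6.29] [cite: CossartPiltant2019, §1] -/
theorem sigmaMaxModifications_iff_open_cores :
    CossartJannsenSaito2020_sigmaMaxElimination.{0} → CossartPiltant2019General.{0} →
    (SigmaMaxModifications ↔
      ((∀ p : ℕ, p.Prime → ∀ (k : Type) [Field k] [CharP k p] (X : Scheme.{0})
      (f : X ⟶ Spec (.of k)), IsSeparated f → LocallyOfFiniteType f → QuasiCompact f →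
      IsReduced X → ¬ Scheme.IsRegular X → ((3 : ℕ) : WithBot ℕ∞) ≤ topologicalKrullDim X →
      topologicalKrullDim X ≤ 3 → ∀ N : ℕ, topologicalKrullDim X ≤ (N : WithBot ℕ∞) →
      ¬ Disjoint (closure ((Scheme.regularLocus X)ᶜ \ Scheme.hsMaxLocus X N))
          (Scheme.hsMaxLocus X N) →
        ∃ (X' : Scheme.{0}) (π : X' ⟶ X), IsProper π ∧ IsReduced X' ∧
          topologicalKrullDim X' ≤ (N : WithBot ℕ∞) ∧
          (∀ U : X.Opens, (U : Set X) ⊆ (Scheme.hsMaxLocus X N)ᶜ → IsIso (π ∣_ U)) ∧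
          Dense ((fun x' => π.base x') ⁻¹' (Scheme.hsMaxLocus X N)ᶜ) ∧
          (∀ x' : X', Scheme.hsFun X' N x' ≤ Scheme.hsFun X N (π.base x')) ∧
          ∀ ν : ℕ → ℕ, Maximal (· ∈ Scheme.hsValues X N) ν → ν ∉ Scheme.hsValues X' N) ∧
       (∀ p : ℕ, p.Prime → ∀ (k : Type) [Field k] [CharP k p] (X : Scheme.{0})
      (f : X ⟶ Spec (.of k)), IsSeparated f → LocallyOfFiniteType f → QuasiCompact f →
      IsReduced X → ¬ Scheme.IsRegular X → ((4 : ℕ) : WithBot ℕ∞) ≤ topologicalKrullDim X →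
      ∀ N : ℕ, topologicalKrullDim X ≤ (N : WithBot ℕ∞) →
        ∃ (X' : Scheme.{0}) (π : X' ⟶ X), IsProper π ∧ IsReduced X' ∧
          topologicalKrullDim X' ≤ (N : WithBot ℕ∞) ∧
          (∀ U : X.Opens, (U : Set X) ⊆ (Scheme.hsMaxLocus X N)ᶜ → IsIso (π ∣_ U)) ∧
          Dense ((fun x' => π.base x') ⁻¹' (Scheme.hsMaxLocus X N)ᶜ) ∧
          (∀ x' : X', Scheme.hsFun X' N x' ≤ Scheme.hsFun X N (π.base x')) ∧
          ∀ ν : ℕ → ℕ, Maximal (· ∈ Scheme.hsValues X N) ν → ν ∉ Scheme.hsValues X' N))) := by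
  intro hCJS hCP
  constructor
  · intro h
    exact ⟨fun p hp k _ _ X f hsep hft hqc hred hreg _ _ N hdim _ =>
        h p hp k X f hsep hft hqc hred hreg N hdim,
      fun p hp k _ _ X f hsep hft hqc hred hreg _ N hdim => h p hp k X f hsep hft hqc hred hreg N hdim⟩
  · rintro ⟨hcorridor, hge4⟩
    exact sigmaMaxModifications_of_open_cores hCJS hCP hcorridor hge4

end Summit.ResolutionOfSingularities.ResolutionOfSingularities.Theorems.SigmaMaxModifications.Sketch

end
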